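import Summits.QuantumFields.BalabanUV.Beta.SpineRecursiveParity
import Summits.QuantumFields.BalabanUV.Beta.SecondOrderLetterParity

/-!
# `BalabanUV.Beta.GAN24.WardLawParitySplit` — row G-an2-4, W-slot EXIT (α) «use the identity, not its defect» (summit-lead RULING R-lead-g77-1), re-cut (α-0):
# THE BLOCK WARD LAW OF A SECOND-ORDER TABLE SPLITS BY ROW PARITY — the parity-EVEN part of the table obeys the law with the COMMUTATOR word alone,
# the parity-ODD part carries the WHOLE residual (OWNER gan24-p1, gen 33; companion of `GAN24.WSlotParityBlind`)

HONEST DEPENDENCY (page 1, mandatory): continuum YM on T⁴ ⇐ BetaPertH ∧ nine spine estimates (0/9 proved); BetaPertH ⇐ (D1) ∧ (D4) ∧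
CAP+tail; G-an2-4 gates asym, D1 and NE2/3/4.  HONEST FRAMING (cell contract, verbatim): «discharging `BetaPertH` makes Bałaban's UV
stability UNCONDITIONAL — a real constructive-QFT result; it is NOT the continuum limit and NOT the Clay problem.»  THIS MODULE DISCHARGES
NOTHING of the wall: [folklore] parity bookkeeping BY NAME over the D1 lane's parity calculus (an1's `KernelWardRemainderParity`, leaf-05's
`SpineRecursiveParity`, an2's `SecondOrderLetterParity` ∕ `BorderedHessian`) and `KernelWard.divW`.  No `def`, no `Prop` minted, nothing printed
asserted, 0 sorry; every parity is a DISPLAYED HYPOTHESIS; NEVER «G-an2-4 closed» as (CONV-C); NOT D1, NOT `BetaPertH`, NOT continuum, NOT Clay.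

ABSOLUTE RULE (cell charter, verbatim): «No internally-minted statement may enter as a cited fact. Every hypothesis is either kernel-proved in
this package or a verbatim quotation of a PUBLISHED theorem with page reference. The manuscript(s) under audit are NOT citable for their own
disputed steps — they are the thing under adjudication; programme-internal (2001/route/tribunal) claims are never citable.»  Nothing is cited here.

## Why (context only; asserted nowhere below)

p2's route-of-record identity for the W-table of the G-an2-4 literal (`GAN24.WardResidualSUnrolled`, (LAW)) reads
`divW (WrecAt j) y ν y′ = conjV (dM G_j Lc S_j M_j ν y′) (X y) + (vertexOfK G_j Lc (Φ j y) ν y′ + Ψ j y ν y′)` — the block Ward law of the level-`j`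
table = the COMMUTATOR word + the Ward-locus RESIDUAL.  Row parity (`trK · = ± sgnK ·`) grades every word: the literal's first-order tables are
parity-ODD at every level (leaf-05 `trK_SrecAt`, `trK_M1At`), so `dM …` is odd (`parityOdd_dM`) and its commutator with a diagonal kernel is
parity-EVEN (`SecondOrderLetterParity.parityEven_conjV_diagK_of_odd`); a residual dressed from parity-odd rows is parity-odd
(`trK_vertexOfK_eq_neg_sgnK_of_rows`).  `divW` acts on the SLOT indices only, so it commutes with `trK` and `sgnK` (§2).  Consequence (§3–§4):
writing the table as `W = We + Wo` with `We` slicewise parity-even and `Wo` slicewise parity-odd, the law SPLITS — `divW We = commutator word`,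
`divW Wo = residual` (the D1 lane's own template for the hW letters: leaf-06's `WardLocusParitySplit` «the CONTENT of a letter is its EVEN-HALF LAW») — and the D1 consumer is blind to `Wo` (`GAN24.WSlotParityBlind`, an1's `tadpole_eq_zero_of_parity`).  Engine E42b (journal,
this gen) measured exactly this at the born level: the transported commutator word is parity-even to 1e-15 and equals the even part of the
transported table word to 1e-12; the whole Ward-defect letter is the odd part.

## What is proved (generic `d`; every parity a hypothesis)

* §1 parity algebra, even side and uniqueness: `parityEven_add ∕ _neg ∕ _sub ∕ _zero ∕ _sum`, **`parity_split_unique`** (`Ae + Ao = Be + Bo` with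
  `Ae, Be` even and `Ao, Bo` odd ⟹ `Ae = Be ∧ Ao = Bo`).
* §2 `trK_divW`, `sgnK_divW`, **`parityEven_divW`**, **`parityOdd_divW`** (slicewise parity of a table family passes to its block divergence); the same for `divV`.
* §3 **`divW_split_of_law`**: `W = We + Wo` slicewise (even ∕ odd), a law `divW W y ν y′ = C y ν y′ + R y ν y′` with `C` even and `R` odd ⟹
  `divW We y ν y′ = C y ν y′` and `divW Wo y ν y′ = R y ν y′`; **`residual_eq_zero_of_even_table`**: if `W` itself is slicewise even, `R ≡ 0` (the law is EXACT).
* §4 the (LAW)'s words: **`parityEven_conjV_dM_diagK`** (the commutator word is even for parity-odd first-order rows, ANY weight kernel),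
  **`parityOdd_vertexOfK_add_of_rows`** (the residual `vertexOfK G (Φ y) ν y′ + Ψ y ν y′` is odd for parity-odd rows of `Φ y` and odd `Ψ`),
  **`divW_even_eq_conjV_dM_of_law`** — §3 instantiated: under the (LAW) shape with those parities, the even table's block Ward law is the commutator
  word ALONE and the odd table's is the residual ALONE.
READING: combined with `WSlotParityBlind` — the consumer's W-slot rows may be asked of `We`, whose Ward law carries NO Ward-locus residual; the
residual tower (route WC-TL's (Q-R) object) constrains only `Wo`, which the consumer does not see.  Whether the literal's `Φ j`, `Ψ j` HAVE these
parities is p2's ∕ an2's word (IR-α1⁺ ∕ IR-α0′); nothing of it is asserted here.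
Unit `b2b-balaban-gan24-p1` (gen 33), road CT-ROUTE ∕ CT-W of row G-an2-4; no existing file touched.
-/

noncomputable section

open Finset
open scoped BigOperators
open Literature.MathematicalPhysics.QuantumFieldTheory
open Literature.MathematicalPhysics.QuantumFieldTheory.Balaban1983to89
open Literature.MathematicalPhysics.QuantumFieldTheory.Balaban1983to89.Beta
open ExpKernelCalculus (MKer)
open OneStepResolventKernel (Fib)
open OneStepKernelFamily (vertexOfK)
open SecondOrderResponse (dM)
open KernelWard (divV divW)
open Summit.QuantumFields.BalabanUV.Beta.TameKernelCalculus (trK trK_apply trK_add trK_sub trK_neg)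
open Summit.QuantumFields.BalabanUV.Beta.BorderedHessian (sgnK sgnK_apply diagK)
open Summit.QuantumFields.BalabanUV.Beta.BubbleParity (sgnK_neg)
open Summit.QuantumFields.BalabanUV.Beta.ChartConjugation (conjV)
open Summit.QuantumFields.BalabanUV.Beta.KernelWardRemainderParity (sgnK_add parityOdd_add trK_vertexOfK_eq_neg_sgnK_of_rows)
open Summit.QuantumFields.BalabanUV.Beta.SpineRecursiveParity (parityOdd_neg parityOdd_zero parityOdd_sum parityOdd_dM)
open Summit.QuantumFields.BalabanUV.Beta.SecondOrderLetterParity (eq_zero_of_even_of_odd parityEven_conjV_diagK_of_odd)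

namespace Summit.QuantumFields.BalabanUV.Beta.GAN24.WardLawParitySplit

variable {d : ℕ}

/-! ## §1 Parity algebra: the even side, and uniqueness of the even ∕ odd split -/

section Algebra

/-- [folklore] The sum of two parity-even kernels is parity-even. -/
theorem parityEven_add {A B : MKer (d + 1) (Fib d)} (hA : trK A = sgnK A) (hB : trK B = sgnK B) : trK (A + B) = sgnK (A + B) := by
  rw [trK_add, hA, hB, sgnK_add]

/-- [folklore] The negation of a parity-even kernel is parity-even (an2's `BubbleParity.sgnK_neg`). -/
theorem parityEven_neg {A : MKer (d + 1) (Fib d)} (hA : trK A = sgnK A) : trK (-A) = sgnK (-A) := by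
  rw [trK_neg, hA, sgnK_neg]

/-- [folklore] The difference of two parity-even kernels is parity-even. -/
theorem parityEven_sub {A B : MKer (d + 1) (Fib d)} (hA : trK A = sgnK A) (hB : trK B = sgnK B) : trK (A - B) = sgnK (A - B) := by
  rw [sub_eq_add_neg]
  exact parityEven_add hA (parityEven_neg hB)

/-- [folklore] The zero kernel is parity-even. -/
theorem parityEven_zero : trK (0 : MKer (d + 1) (Fib d)) = sgnK (0 : MKer (d + 1) (Fib d)) := by
  funext x z a b
  simp [trK_apply, sgnK_apply]

/-- [folklore] A finite sum of parity-even kernels is parity-even. -/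
theorem parityEven_sum {ι : Type*} (s : Finset ι) {A : ι → MKer (d + 1) (Fib d)} (h : ∀ i ∈ s, trK (A i) = sgnK (A i)) :
    trK (∑ i ∈ s, A i) = sgnK (∑ i ∈ s, A i) := by
  classical
  induction s using Finset.induction_on with
  | empty => simpa using (parityEven_zero (d := d))
  | insert i s hi ih =>
    rw [Finset.sum_insert hi]
    exact parityEven_add (h i (Finset.mem_insert_self i s)) (ih fun k hk => h k (Finset.mem_insert_of_mem hk))

/-- [folklore] **UNIQUENESS OF THE PARITY SPLIT**: `Ae + Ao = Be + Bo` with `Ae`, `Be` parity-even and `Ao`, `Bo` parity-odd ⟹ `Ae = Be` and `Ao = Bo`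
(the difference `Ae − Be = Bo − Ao` is both even and odd, hence zero — an2's `eq_zero_of_even_of_odd`). -/
theorem parity_split_unique {Ae Ao Be Bo : MKer (d + 1) (Fib d)} (hAe : trK Ae = sgnK Ae) (hAo : trK Ao = -sgnK Ao)
    (hBe : trK Be = sgnK Be) (hBo : trK Bo = -sgnK Bo) (h : Ae + Ao = Be + Bo) : Ae = Be ∧ Ao = Bo := by
  have hd : Ae - Be = Bo - Ao := by
    funext x z a b
    have e := congrFun (congrFun (congrFun (congrFun h x) z) a) b
    simp only [Pi.add_apply, Pi.sub_apply] at e ⊢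
    linarith
  have h0 : Ae - Be = 0 := eq_zero_of_even_of_odd (parityEven_sub hAe hBe) (by rw [hd, sub_eq_add_neg]; exact parityOdd_add hBo (parityOdd_neg hAo))
  have h1 : Ae = Be := sub_eq_zero.mp h0
  refine ⟨h1, ?_⟩
  have : Bo - Ao = 0 := by rw [← hd, h0]
  exact (sub_eq_zero.mp this).symm

end Algebra

/-! ## §2 The block divergence acts on the slot indices: it commutes with `trK` and `sgnK` -/

section Div

/-- [folklore] **`trK` COMMUTES WITH THE BLOCK DIVERGENCE OF A SECOND-ORDER TABLE** (`divW` is a finite signed sum of slices). -/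
theorem trK_divW (W : Fin (d + 1) → (Fin (d + 1) → ℤ) → Fin (d + 1) → (Fin (d + 1) → ℤ) → MKer (d + 1) (Fib d))
    (y : Fin (d + 1) → ℤ) (ν : Fin (d + 1)) (y' : Fin (d + 1) → ℤ) :
    trK (divW W y ν y') = divW (fun μ y ν y' => trK (W μ y ν y')) y ν y' := by
  funext x z a b
  simp only [KernelWard.divW, trK_apply, Finset.sum_apply, Pi.sub_apply]

/-- [folklore] **`sgnK` COMMUTES WITH THE BLOCK DIVERGENCE OF A SECOND-ORDER TABLE.** -/
theorem sgnK_divW (W : Fin (d + 1) → (Fin (d + 1) → ℤ) → Fin (d + 1) → (Fin (d + 1) → ℤ) → MKer (d + 1) (Fib d))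
    (y : Fin (d + 1) → ℤ) (ν : Fin (d + 1)) (y' : Fin (d + 1) → ℤ) :
    sgnK (divW W y ν y') = divW (fun μ y ν y' => sgnK (W μ y ν y')) y ν y' := by
  funext x z a b
  simp only [KernelWard.divW, sgnK_apply, Finset.sum_apply, Pi.sub_apply, Finset.mul_sum, mul_sub]

/-- [folklore] **A SLICEWISE PARITY-EVEN TABLE HAS PARITY-EVEN BLOCK DIVERGENCE.** -/
theorem parityEven_divW {W : Fin (d + 1) → (Fin (d + 1) → ℤ) → Fin (d + 1) → (Fin (d + 1) → ℤ) → MKer (d + 1) (Fib d)}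
    (hW : ∀ μ y ν y', trK (W μ y ν y') = sgnK (W μ y ν y')) (y : Fin (d + 1) → ℤ) (ν : Fin (d + 1)) (y' : Fin (d + 1) → ℤ) :
    trK (divW W y ν y') = sgnK (divW W y ν y') := by
  rw [trK_divW, sgnK_divW]
  congr 1
  funext μ y ν y'
  exact hW μ y ν y'

/-- [folklore] **A SLICEWISE PARITY-ODD TABLE HAS PARITY-ODD BLOCK DIVERGENCE.** -/
theorem parityOdd_divW {W : Fin (d + 1) → (Fin (d + 1) → ℤ) → Fin (d + 1) → (Fin (d + 1) → ℤ) → MKer (d + 1) (Fib d)}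
    (hW : ∀ μ y ν y', trK (W μ y ν y') = -sgnK (W μ y ν y')) (y : Fin (d + 1) → ℤ) (ν : Fin (d + 1)) (y' : Fin (d + 1) → ℤ) :
    trK (divW W y ν y') = -sgnK (divW W y ν y') := by
  unfold KernelWard.divW
  exact parityOdd_sum _ fun μ _ => by rw [sub_eq_add_neg]; exact parityOdd_add (hW μ _ ν y') (parityOdd_neg (hW μ y ν y'))

/-- [folklore] `trK` commutes with the block divergence of a first-order family. -/
theorem trK_divV (V : Fin (d + 1) → (Fin (d + 1) → ℤ) → MKer (d + 1) (Fib d)) (y : Fin (d + 1) → ℤ) :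
    trK (divV V y) = divV (fun μ y => trK (V μ y)) y := by
  funext x z a b
  simp only [KernelWard.divV, trK_apply, Finset.sum_apply, Pi.sub_apply]

/-- [folklore] A slicewise parity-odd first-order family has parity-odd block divergence. -/
theorem parityOdd_divV {V : Fin (d + 1) → (Fin (d + 1) → ℤ) → MKer (d + 1) (Fib d)} (hV : ∀ μ y, trK (V μ y) = -sgnK (V μ y))
    (y : Fin (d + 1) → ℤ) : trK (divV V y) = -sgnK (divV V y) := by
  unfold KernelWard.divV
  exact parityOdd_sum _ fun μ _ => by rw [sub_eq_add_neg]; exact parityOdd_add (hV μ _) (parityOdd_neg (hV μ y))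

end Div

/-! ## §3 The split of a block Ward law -/

section Split

variable {W We Wo : Fin (d + 1) → (Fin (d + 1) → ℤ) → Fin (d + 1) → (Fin (d + 1) → ℤ) → MKer (d + 1) (Fib d)}
  {C R : (Fin (d + 1) → ℤ) → Fin (d + 1) → (Fin (d + 1) → ℤ) → MKer (d + 1) (Fib d)}

/-- [folklore] **THE BLOCK WARD LAW SPLITS BY PARITY.**  If the table decomposes slicewise as `W = We + Wo` with `We` parity-even and `Wo` parity-odd,
and obeys a law `divW W y ν y′ = C y ν y′ + R y ν y′` with an EVEN word `C` and an ODD word `R`, then the even table obeys the law with `C` ALONE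
and the odd table with `R` ALONE: `divW We y ν y′ = C y ν y′` and `divW Wo y ν y′ = R y ν y′` (§2 + uniqueness of the split). -/
theorem divW_split_of_law (hsplit : ∀ μ y ν y', W μ y ν y' = We μ y ν y' + Wo μ y ν y')
    (hWe : ∀ μ y ν y', trK (We μ y ν y') = sgnK (We μ y ν y')) (hWo : ∀ μ y ν y', trK (Wo μ y ν y') = -sgnK (Wo μ y ν y'))
    (hlaw : ∀ y ν y', divW W y ν y' = C y ν y' + R y ν y')
    (hC : ∀ y ν y', trK (C y ν y') = sgnK (C y ν y')) (hR : ∀ y ν y', trK (R y ν y') = -sgnK (R y ν y'))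
    (y : Fin (d + 1) → ℤ) (ν : Fin (d + 1)) (y' : Fin (d + 1) → ℤ) :
    divW We y ν y' = C y ν y' ∧ divW Wo y ν y' = R y ν y' := by
  have hW : W = fun μ y ν y' => We μ y ν y' + Wo μ y ν y' := by
    funext μ y ν y'; exact hsplit μ y ν y'
  have hsum : divW W y ν y' = divW We y ν y' + divW Wo y ν y' := by
    rw [hW]
    funext x z a b
    simp only [KernelWard.divW, Finset.sum_apply, Pi.sub_apply, Pi.add_apply, ← Finset.sum_add_distrib]
    refine Finset.sum_congr rfl fun μ _ => ?_
    ring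
  exact parity_split_unique (parityEven_divW hWe y ν y') (parityOdd_divW hWo y ν y') (hC y ν y') (hR y ν y')
    (hsum.symm.trans (hlaw y ν y'))

/-- [folklore] **A SLICEWISE PARITY-EVEN TABLE OBEYS ITS BLOCK WARD LAW EXACTLY**: if `W` is slicewise parity-even and `divW W = C + R` with `C`
even and `R` odd, then `R y ν y′ = 0` and `divW W y ν y′ = C y ν y′` (an2's `odd_eq_zero_of_even_letter` read for the W-law). -/
theorem residual_eq_zero_of_even_table (hWe : ∀ μ y ν y', trK (W μ y ν y') = sgnK (W μ y ν y'))
    (hlaw : ∀ y ν y', divW W y ν y' = C y ν y' + R y ν y')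
    (hC : ∀ y ν y', trK (C y ν y') = sgnK (C y ν y')) (hR : ∀ y ν y', trK (R y ν y') = -sgnK (R y ν y'))
    (y : Fin (d + 1) → ℤ) (ν : Fin (d + 1)) (y' : Fin (d + 1) → ℤ) :
    R y ν y' = 0 ∧ divW W y ν y' = C y ν y' := by
  have h := divW_split_of_law (W := W) (We := W) (Wo := fun _ _ _ _ => 0) (fun μ y ν y' => by simp) hWe
    (fun μ y ν y' => parityOdd_zero) hlaw hC hR y ν y'
  have h0 : divW (fun (_ : Fin (d + 1)) (_ : Fin (d + 1) → ℤ) (_ : Fin (d + 1)) (_ : Fin (d + 1) → ℤ) => (0 : MKer (d + 1) (Fib d))) y ν y' = 0 := by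
    funext x z a b
    simp [KernelWard.divW]
  refine ⟨?_, h.1⟩
  rw [← h.2, h0]

end Split

/-! ## §4 The words of the literal's block Ward law -/

section Words

variable {N : ℕ}

/-- [folklore] **THE COMMUTATOR WORD IS PARITY-EVEN**: for parity-odd first-order rows `S`, `M` (the literal's: leaf-05 `trK_SrecAt`, `trK_M1At`),
ANY weight kernel `K`, any slot `(ν, y′)` and any diagonal symbol `g`, `trK (conjV (dM K N S M ν y′) (diagK g)) = sgnK (conjV (dM K N S M ν y′) (diagK g))`
(`parityOdd_dM` ⨾ `parityEven_conjV_diagK_of_odd`). -/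
theorem parityEven_conjV_dM_diagK (K : MKer (d + 1) (Fib d)) {S M : Fin (d + 1) → (Fin (d + 1) → ℤ) → MKer (d + 1) (Fib d)}
    (hS : ∀ κ u, trK (S κ u) = -sgnK (S κ u)) (hM : ∀ ρ w, trK (M ρ w) = -sgnK (M ρ w)) (ν : Fin (d + 1)) (y' : Fin (d + 1) → ℤ)
    (g : (Fin (d + 1) → ℤ) → Fib d → ℝ) :
    trK (conjV (dM K N S M ν y') (diagK g)) = sgnK (conjV (dM K N S M ν y') (diagK g)) :=
  parityEven_conjV_diagK_of_odd g (parityOdd_dM K N hS hM ν y')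

/-- [folklore] **THE RESIDUAL WORD IS PARITY-ODD**: for a stencil `Φy` with parity-odd rows, ANY weight kernel `G`, and a parity-odd `Ψ y ν y′`,
`trK (vertexOfK G N Φy ν y′ + Ψ y ν y′) = −sgnK (…)` (`trK_vertexOfK_eq_neg_sgnK_of_rows` ⨾ `parityOdd_add`). -/
theorem parityOdd_vertexOfK_add_of_rows (G : MKer (d + 1) (Fib d)) {Φy : Fin (d + 1) → (Fin (d + 1) → ℤ) → MKer (d + 1) (Fib d)}
    (hΦ : ∀ κ u, trK (Φy κ u) = -sgnK (Φy κ u)) {Ψ' : MKer (d + 1) (Fib d)} (hΨ : trK Ψ' = -sgnK Ψ') (ν : Fin (d + 1))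
    (y' : Fin (d + 1) → ℤ) : trK (vertexOfK G N Φy ν y' + Ψ') = -sgnK (vertexOfK G N Φy ν y' + Ψ') :=
  parityOdd_add (trK_vertexOfK_eq_neg_sgnK_of_rows G hΦ ν y') hΨ

/-- [folklore] **THE (LAW) SPLIT**: a table `W` with the block Ward law of p2's shape
`divW W y ν y′ = conjV (dM K N S M ν y′) (diagK (g y)) + (vertexOfK G N (Φ y) ν y′ + Ψ y ν y′)`,
parity-odd rows for `S`, `M`, for every `Φ y`, and parity-odd `Ψ y ν y′`, decomposed slicewise as `W = We + Wo` (even ∕ odd) ⟹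
`divW We y ν y′ = conjV (dM K N S M ν y′) (diagK (g y))` — THE EVEN TABLE's WARD LAW IS THE COMMUTATOR WORD ALONE — and
`divW Wo y ν y′ = vertexOfK G N (Φ y) ν y′ + Ψ y ν y′` — THE RESIDUAL LIVES IN THE ODD TABLE. -/
theorem divW_even_eq_conjV_dM_of_law
    {W We Wo : Fin (d + 1) → (Fin (d + 1) → ℤ) → Fin (d + 1) → (Fin (d + 1) → ℤ) → MKer (d + 1) (Fib d)}
    (hsplit : ∀ μ y ν y', W μ y ν y' = We μ y ν y' + Wo μ y ν y')
    (hWe : ∀ μ y ν y', trK (We μ y ν y') = sgnK (We μ y ν y')) (hWo : ∀ μ y ν y', trK (Wo μ y ν y') = -sgnK (Wo μ y ν y'))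
    (K G : MKer (d + 1) (Fib d)) {S M : Fin (d + 1) → (Fin (d + 1) → ℤ) → MKer (d + 1) (Fib d)}
    (hS : ∀ κ u, trK (S κ u) = -sgnK (S κ u)) (hM : ∀ ρ w, trK (M ρ w) = -sgnK (M ρ w))
    (g : (Fin (d + 1) → ℤ) → (Fin (d + 1) → ℤ) → Fib d → ℝ)
    {Φ : (Fin (d + 1) → ℤ) → Fin (d + 1) → (Fin (d + 1) → ℤ) → MKer (d + 1) (Fib d)} (hΦ : ∀ y κ u, trK (Φ y κ u) = -sgnK (Φ y κ u))
    {Ψ : (Fin (d + 1) → ℤ) → Fin (d + 1) → (Fin (d + 1) → ℤ) → MKer (d + 1) (Fib d)} (hΨ : ∀ y ν y', trK (Ψ y ν y') = -sgnK (Ψ y ν y'))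
    (hlaw : ∀ y ν y', divW W y ν y' = conjV (dM K N S M ν y') (diagK (g y)) + (vertexOfK G N (Φ y) ν y' + Ψ y ν y'))
    (y : Fin (d + 1) → ℤ) (ν : Fin (d + 1)) (y' : Fin (d + 1) → ℤ) :
    divW We y ν y' = conjV (dM K N S M ν y') (diagK (g y)) ∧ divW Wo y ν y' = vertexOfK G N (Φ y) ν y' + Ψ y ν y' :=
  divW_split_of_law (C := fun y ν y' => conjV (dM K N S M ν y') (diagK (g y))) (R := fun y ν y' => vertexOfK G N (Φ y) ν y' + Ψ y ν y')
    hsplit hWe hWo hlaw (fun y ν y' => parityEven_conjV_dM_diagK K hS hM ν y' (g y))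
    (fun y ν y' => parityOdd_vertexOfK_add_of_rows G (hΦ y) (hΨ y ν y') ν y') y ν y'

/-- [folklore] **IF THE TABLE IS SLICEWISE PARITY-EVEN, THE WARD-LOCUS RESIDUAL WORD VANISHES** under the same parities: the (LAW) then reads
`divW W y ν y′ = conjV (dM K N S M ν y′) (diagK (g y))` EXACTLY and `vertexOfK G N (Φ y) ν y′ + Ψ y ν y′ = 0`. -/
theorem residual_eq_zero_of_even_table_of_law
    {W : Fin (d + 1) → (Fin (d + 1) → ℤ) → Fin (d + 1) → (Fin (d + 1) → ℤ) → MKer (d + 1) (Fib d)}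
    (hWe : ∀ μ y ν y', trK (W μ y ν y') = sgnK (W μ y ν y')) (K G : MKer (d + 1) (Fib d))
    {S M : Fin (d + 1) → (Fin (d + 1) → ℤ) → MKer (d + 1) (Fib d)}
    (hS : ∀ κ u, trK (S κ u) = -sgnK (S κ u)) (hM : ∀ ρ w, trK (M ρ w) = -sgnK (M ρ w))
    (g : (Fin (d + 1) → ℤ) → (Fin (d + 1) → ℤ) → Fib d → ℝ)
    {Φ : (Fin (d + 1) → ℤ) → Fin (d + 1) → (Fin (d + 1) → ℤ) → MKer (d + 1) (Fib d)} (hΦ : ∀ y κ u, trK (Φ y κ u) = -sgnK (Φ y κ u))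
    {Ψ : (Fin (d + 1) → ℤ) → Fin (d + 1) → (Fin (d + 1) → ℤ) → MKer (d + 1) (Fib d)} (hΨ : ∀ y ν y', trK (Ψ y ν y') = -sgnK (Ψ y ν y'))
    (hlaw : ∀ y ν y', divW W y ν y' = conjV (dM K N S M ν y') (diagK (g y)) + (vertexOfK G N (Φ y) ν y' + Ψ y ν y'))
    (y : Fin (d + 1) → ℤ) (ν : Fin (d + 1)) (y' : Fin (d + 1) → ℤ) :
    vertexOfK G N (Φ y) ν y' + Ψ y ν y' = 0 ∧ divW W y ν y' = conjV (dM K N S M ν y') (diagK (g y)) :=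
  residual_eq_zero_of_even_table (C := fun y ν y' => conjV (dM K N S M ν y') (diagK (g y)))
    (R := fun y ν y' => vertexOfK G N (Φ y) ν y' + Ψ y ν y') hWe hlaw (fun y ν y' => parityEven_conjV_dM_diagK K hS hM ν y' (g y))
    (fun y ν y' => parityOdd_vertexOfK_add_of_rows G (hΦ y) (hΨ y ν y') ν y') y ν y'

end Words

end Summit.QuantumFields.BalabanUV.Beta.GAN24.WardLawParitySplit

end
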